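import Summits.QuantumFields.YangMills.Theorems.BalabanUVNodesN05SubBP2DSlotExistsLawLanGammaPrime
import Summits.QuantumFields.YangMills.Theorems.BalabanUVNodesN05AtRecord13SubBP2DSepCoPH
import Literature.MathematicalPhysics.QuantumFieldTheory.Balaban1983to89.Node00.Record13CarriersB8SubBP2DCoPHG

/-!
# BalabanUVNodes ∕ N05 ([B8], `Dag.B8_main`) AT THE STAGE-13 RECORD OF RECORD — PRINT'S BACKGROUND (v1.7 key `SepCoPH`), «P₂D» PIN, SC-BINDING: N05 IN ∃-CURRENCY AT
# THE ONE-PIN CoPH RECORD `Node00.IsRecordOfRecord₁₃CSepCoPHSB8subBP₂D` (§1) AND IN THE `b8`-GENERIC S-CLASS `Node00.IsRecordOfRecord₁₃CSepCoPHG` (§2), FED BY THE FIVE (1.5)-KEYED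
# [4]-TYPE FAMILIES ALONE — the CoPH-keyed record images of dag-n05-d g12's ∃λ theorem (11)
# `BalabanUVNodesN05SubBP2DSlotExistsLawLanGammaPrime.exists_residB8_b8LeafOfRecordSubBP₂D_cutSubBP₅_of_lettersSrc_γ'` (p619291; the layer CUT AT dag-n05-w1's P₅-PIN
# `λ.cutSubBP₅ c₁ ρ₀`, `Node00/CarriersB8SubBPCutP5` p618280 — Proposition 5's family = print's p. 94 family BY NAME, no ∃ over its carriers) through this seat's slot closers

Track A of `YM-PLAN.md` (cell `pub-ymgap`, HUMAN RULING D-0062 ∕ D-0149 width seats), node **N05** = [Balaban1985RegularSpaces] Lemma 1, Thm 2, Prop 3, Thm 4, Props 5–7,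
Thm 8; width seat `pub-ymgap-dag-n05-w4` (g3), 2026-08-28, key item K1⁸ `StabilityBRunRowsAtRecordR13SepCoPH` (dag-lead KEY MAP v1.65; `--supports`, helper; count-neutral).
«P₂D» EDITION of the image this lineage HELD at «P₂C» (g2's `…SubBP2CSepCoPHOfSocketsGammaPrime`, never filed: its [4]-letters binders over `Ω₀ = ℤᵈ ∧ IdxB8LawsB ∧ DomainSeq`
were UNSATISFIABLE as typed — dag-n05-w1 g2's certificate `B8SockLettersRDIdxB8LawsBVacuity`, p613168; dag-n05-d g12 DESIGN WORD «P₂D», cell bus 2026-08-28 07:54Z: every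
class-wide binder now carries dag-n05-c's (1.5) corner letter `(∀ l, l < i.k → ∀ z ∈ i.Λs i.k l, ((θ.L : ℤ) ^ l) • z ∈ B8ConstraintBonds.Lam θ.L i.Ω l) →`, the `i⋆` obstruction
excluded by construction).  The Sep-keyed one-pin image `…N05AtRecord13SubBP2DSepOfSocketsGammaPrime` is dag-n05-d's (E2ᴰ); THIS FILE is the CoPH-keyed one-pin image + its G-class
form (the K1⁸ key is CoPH): §1 on dag-n05-w1 g2's `Node00/Record13CarriersB8SubBP2DCoPH` (p620524) through this seat's `…N05AtRecord13SubBP2DSepCoPH.exists_isRecordOfRecord₁₃CSepCoPHSB8subBP₂D_b8_of_leaf`,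
§2 through dag-n05-w1 g2's G-slice `Node00/Record13CarriersB8SubBP2DCoPHG` (p621632); the engine's four-pin X-P₂D view image is the sibling `…N05AtXPinnedP2DSViewSepCoPHOfSocketsGammaPrime`.

* §1 ★ `exists_isRecordOfRecord₁₃CSepCoPHSB8subBP₂D_b8_of_lettersSrc_γ'` — for `θ : Stage13HParams F N` with `Provisos₁₃SepCoPH`, `Admissible`, `5 ≤ L`, any window `0 < γw ≤ θ.γ`,
  and the SAME hypotheses as (11) over `θ.toStage3Params` ([Balaban1985BackgroundPropagators]'s primitive constants, the letters `SLet ∕ SLetUB` and the b9 sockets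
  `SB9P ∕ SH59src ∕ SB9srcHP` at the (1.3)–(1.5)-ADMISSIBLE `Ω₀ = ℤᵈ` law members — HYPOTHESES; Theorem 8's socket-side constants and the guard `2 ≤ 5dLB₀`): `∃ lam c₁ ρ₀ w w′`,
  `IsRecordOfRecord₁₃CSepCoPHSB8subBP₂D F N (datumOfRecord₁₃SepCoPH F N θ h) w` with its SC-binding DISPLAYED at `θ.pinB8SubBP₂D (lam.cutSubBP₅ c₁ ρ₀)` (the layer cut at the
  P₅-pin: Proposition 5 is read on print's p. 94 family BY NAME — no certificate conjunct needed), `w.C ∕ w.γ = γw ∕ w.L`, EVERY run's `b8` leaf and `Dag.B8_main`, and the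
  same-datum `₁₃CSepCoPH` companion `w′` (leaves equal off `b8`).  Proof: `obtain` (11) + `exact` §1-closer.
* §2 ★ `exists_isRecordOfRecord₁₃CSepCoPHG_b8_of_lettersSrc_γ'` — §1 read in the `b8`-GENERIC S-class `IsRecordOfRecord₁₃CSepCoPHG` (through dag-n05-w1 g2's G-slice p621632;
  their OFFER (a), cell bus 09:37Z): `∃ lam c₁ ρ₀ w`, G-class record, `w.γ = γw`, binding displayed, every run's `b8` + `Dag.B8_main`.
NO `p5e p5u p6 p7 t8 …` is displayed: Proposition 5 is read on print's p. 94 family at the P₅-pin (index `IdxB8LanC θ`, members `zdLan ∘ toZdLanIdx`), Proposition 6 at print's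
cube of record, Proposition 7 in the repaired currency, Theorem 8 knit in — all INSIDE (11); what remains displayed is N06 content.

HONEST FRAMING: kernel bookkeeping by name (`obtain` + `exact` per theorem); NO estimate; nothing of [Balaban1985RegularSpaces] ∕ [Balaban1985BackgroundPropagators]
asserted — the five [4]-type families are HYPOTHESES (N06 content at `m ≥ 1`, OPEN; satisfiability class-wise NOT claimed here; no positive A6 witness at m ≥ 1 claimed);
∃-currency over the layer AND the world; `5 ≤ L` a guard on the presenting parameter; Proposition 7 inside the slot in the repaired currency `c₇OfRecord θ₃` (WEAKER than
print's `2α₂`, WATCH-P7-CURRENCY-RECORD); the booking of either record as N05's statement of record is the planners' ∕ chair's; count-neutral; **N05 NOT discharged**; K1 NOT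
claimed; no count claim; Bałaban AS PRINTED with locators; one finite 𝕋⁴ programme at fixed ε — the Yang–Mills mass gap (Clay) is NOT proved by any of this; R4 closes the
conditional finite-𝕋⁴ rung `BalabanLadder.UV` only; nothing continuum ∕ ℝ⁴ ∕ OS.  No `sorry`, no new definition, no `instance`, no `notation`.  Unit `pub-ymgap-dag-n05-w4` (g3), 2026-08-28.
[cite: Balaban1985RegularSpaces, Lemma 1 p.79, Thm 2 p.83, Prop. 3 p.87, Thm 4 p.88, Prop. 5 (1.106)–(1.110) p.94, Prop. 6 (1.131)–(1.138) pp.98–99, Prop. 7 (1.144)–(1.145) p.100, (1.3)–(1.5) p.77, Thm 8 (1.146) p.101; Balaban1985BackgroundPropagators, Thm 3.1 p.397, Thm 3.3 p.398, (3.40) p.397 (hypotheses); Balaban1989LargeFieldII, Thm 1 + (0.1) pp.355–356 (the record, bookkeeping)]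
-/

noncomputable section

namespace Summit.QuantumFields.YangMills.BalabanUVNodes.N05AtRecord13SubBP2DSepCoPHOfSocketsGammaPrime

open Literature.MathematicalPhysics.QuantumFieldTheory.Balaban1983to89
open Literature.MathematicalPhysics.QuantumFieldTheory.Balaban1983to89.Node00
open Literature.MathematicalPhysics.QuantumFieldTheory.Balaban1983to89.T4Continuum
open Literature.MathematicalPhysics.QuantumFieldTheory.Balaban1983to89.DagBinding
open Literature.MathematicalPhysics.QuantumFieldTheory.Balaban1983to89.B8IdxB8LawsB (IdxB8LawsB IdxB8SubB)
open Literature.MathematicalPhysics.QuantumFieldTheory.Balaban1983to89.B8LeafModelZd (ZdIdx)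
open Literature.MathematicalPhysics.QuantumFieldTheory.Balaban1983to89.B8LeafModelZd3 (SockB9P3)
open Literature.MathematicalPhysics.QuantumFieldTheory.Balaban1983to89.B9SupplySockB9P3ZdGammaUnivDelta2 (SockB9P3H2)
open Literature.MathematicalPhysics.QuantumFieldTheory.Balaban1983to89.B8LeafModelZd3P (zdGF3P zdGF3HP)
open Literature.MathematicalPhysics.QuantumFieldTheory.Balaban1983to89.B8LeafModelZd3P2 (zdGF3P₂ zdGF3HP₂)
open Literature.MathematicalPhysics.QuantumFieldTheory.Balaban1983to89.B8TowerBondsPrinted (towerBondsP)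
open Literature.MathematicalPhysics.QuantumFieldTheory.Balaban1983to89.B8SockLettersRD (SockLettersRD)
open Literature.MathematicalPhysics.QuantumFieldTheory.Balaban1983to89.B8Lemma1NonAbelian (mulCfg blockPairNA)
open Literature.MathematicalPhysics.QuantumFieldTheory.Balaban1983to89.B8LanF146 (LanF146)
open Literature.MathematicalPhysics.QuantumFieldTheory.Balaban1983to89.B8Eq138LandauZd (covLap QT InR138 IsLandau146W)
open Literature.MathematicalPhysics.QuantumFieldTheory.Balaban1983to89.B8Prop5LandauDataZd (ZdLanIdx zdLan)
open Summit.QuantumFields.YangMills.BalabanUVNodes.N05SubBP2DSlotExistsLawLanGammaPrime (exists_residB8_b8LeafOfRecordSubBP₂D_cutSubBP₅_of_lettersSrc_γ')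
open MatrixLog B7Prop1Explicit B7Prop2Explicit B7Prop1Local B7Eq92Concrete
open B8Ineq130 (tlo thi)
open B8Ineq132 (InAk covDerivFwd)
open B7Eq78Linearization (zdBlocking QprimeIter)
open B8Eq119TwistedAxial (bgT Restr129 InAx)
open B8Eq140Level (SideTouches)
open B8Eq1117Concrete (XSpace)
open B8Prop5ContractionKLevel (Bd2)
open B8LambdaSpaceKLevel (wt)
open B8Eq184Proof (gaugeExp cfgExp)
open B8Eq146AExpansion (iEta plaqCovDeriv)
open B8Eq143PlaqExpansion (pdiv)
open B7Prop4GeneralLevels (linCovIter)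
open B8Eq155JBound (Jcur wsup)
open B8ScaledSupNorm (bondNorm msup Bdd)
open B9Eq340HolderZd (hquot AdmPair)
open scoped Matrix.Norms.L2Operator

-- `Site` alone could resolve to the torus sites of `Setup.lean`; re-export the `ℤ^d` sites of `B7Prop1Explicit`.
export B7Prop1Explicit (Site)
open Summit.QuantumFields.YangMills.BalabanUVNodes.N05AtRecord13SubBP2DSepCoPH (exists_isRecordOfRecord₁₃CSepCoPHSB8subBP₂D_b8_of_leaf)

/-! ## §1. N05 in ∃-currency at the one-pin CoPH «P₂D» record, from the five (1.5)-keyed [4]-type families (dag-n05-d's (11) ∘ this seat's slot closer) -/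

section AtRecordCoPH

variable {F : T4Family} {N : ℕ} [NeZero N]

/-- ★ **N05 AT A [B8″P₂D]-PINNED v1.7 (CoPH-keyed) SEPARATED-RANGE STAGE-13 RECORD OF EVERY ADMISSIBLE PARAMETER, FROM THE [4]-TYPE SOCKETS ALONE** (∃-currency over the
residual [B8] layer — cut at dag-n05-w1's P₅-pin `λ.cutSubBP₅ c₁ ρ₀` — and the world; same-datum `₁₃CSepCoPH` companion): for `θ : Stage13HParams F N` presenting a separated-range datum
(`Provisos₁₃SepCoPH`, `Admissible`, `5 ≤ L`), any window `0 < γw ≤ θ.γ`, and the hypotheses of dag-n05-d's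
`exists_residB8_b8LeafOfRecordSubBP₂D_cutSubBP₅_of_lettersSrc_γ'` over `θ.toStage3Params` ([Balaban1985BackgroundPropagators]'s primitive constants, letters `SLet SLetUB`, b9 sockets
`SB9P SH59src SB9srcHP` at the (1.3)–(1.5)-admissible law members — HYPOTHESES): `∃ lam c₁ ρ₀ w w′` — the record `IsRecordOfRecord₁₃CSepCoPHSB8subBP₂D F N (datumOfRecord₁₃SepCoPH F N θ h) w`
bound by `upOfRecord₅CSC` over the pinned v1.7 view at the cut layer `lam.cutSubBP₅ c₁ ρ₀`, `w.γ = γw`, every run's `b8` leaf and `Dag.B8_main`, and the companion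
`w′ ∈ IsRecordOfRecord₁₃CSepCoPH` at the same datum with leaves equal off `b8`.  Proof: (11) (`2 ≤ D` from admissibility) ∘ `exists_isRecordOfRecord₁₃CSepCoPHSB8subBP₂D_b8_of_leaf`.  Sockets ∕ letters are HYPOTHESES (N06); N05 NOT discharged.
[cite: Balaban1985RegularSpaces, Lemma 1 – Thm 8 pp.79–101, Prop. 5 (1.106)–(1.110) p.94, Thm 8 (1.146) p.101; Balaban1985BackgroundPropagators, Thm 3.1 p.397, Thm 3.3 p.398; Balaban1989LargeFieldII, Thm 1 + (0.1) pp.355–356 (bookkeeping)] -/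
theorem exists_isRecordOfRecord₁₃CSepCoPHSB8subBP₂D_b8_of_lettersSrc_γ' (θ : Stage13HParams F N) (h : θ.Provisos₁₃SepCoPH F N) (hθ : θ.Admissible F N)
    (hL5 : 5 ≤ θ.toStage3Params.L) {γw : ℝ} (hγ0 : 0 < γw) (hγ1 : γw ≤ θ.γ)
    -- [Balaban1985BackgroundPropagators]'s PRIMITIVE constants read by the sockets: `B₀` (3.40), the Hölder pair `(β, B₀(β₀))` and length function, [4]'s letter bounds
    {B₀ B₀β β : ℝ} {len : Site θ.toStage3Params.D → ℝ}
    {cB9 B₀'H B₂' BG BR cL : ℝ}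
    (hcB9 : 0 < cB9) (hB₀'H : 0 < B₀'H) (hB₂' : 0 ≤ B₂') (hBG : 0 ≤ BG) (hBR : 0 ≤ BR) (hcL : 0 < cL)
    -- [4]'s letters AT THE `Ω₀ = ℤᵈ` LAW MEMBERS ONLY: existence side (laws on print's domains) and uniqueness side
    (SLet : ∀ i : ZdIdx θ.toStage3Params.D θ.toStage3Params.L, i.Ω 0 = Set.univ → IdxB8LawsB θ.toStage3Params.L i → B8ConstraintBonds.DomainSeq θ.toStage3Params.L i.Ω → (∀ l, l < i.k → ∀ z ∈ i.Λs i.k l, ((θ.toStage3Params.L : ℤ) ^ l) • z ∈ B8ConstraintBonds.Lam θ.toStage3Params.L i.Ω l) → SockLettersRD (𝔸 := θ.toStage3Params.𝔸) θ.toStage3Params.L BG BR B₀'H B₂' cL i.η i.k i.Ω i.Λs)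
    (SLetUB : ∀ i : ZdIdx θ.toStage3Params.D θ.toStage3Params.L, i.Ω 0 = Set.univ → IdxB8LawsB θ.toStage3Params.L i → B8ConstraintBonds.DomainSeq θ.toStage3Params.L i.Ω → (∀ l, l < i.k → ∀ z ∈ i.Λs i.k l, ((θ.toStage3Params.L : ℤ) ^ l) • z ∈ B8ConstraintBonds.Lam θ.toStage3Params.L i.Ω l) → ∀ α₀ : ℝ, 0 < α₀ → α₀ ≤ cL → ∀ U₀ : Site θ.toStage3Params.D → Fin θ.toStage3Params.D → θ.toStage3Params.𝔸ˣ, (∀ x κ, U₀ x κ ∈ unitaryUnits θ.toStage3Params.𝔸) →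
      InAk θ.toStage3Params.L i.k i.η α₀ i.Ω U₀ →
      ∃ (g Δ : (Site θ.toStage3Params.D → θ.toStage3Params.𝔸) →ₗ[ℂ] (Site θ.toStage3Params.D → θ.toStage3Params.𝔸)) (q : (Site θ.toStage3Params.D → θ.toStage3Params.𝔸) →ₗ[ℂ] (ℕ → Site θ.toStage3Params.D → θ.toStage3Params.𝔸))
        (qs : (ℕ → Site θ.toStage3Params.D → θ.toStage3Params.𝔸) →ₗ[ℂ] (Site θ.toStage3Params.D → θ.toStage3Params.𝔸)) (Aw c : (ℕ → Site θ.toStage3Params.D → θ.toStage3Params.𝔸) →ₗ[ℂ] (ℕ → Site θ.toStage3Params.D → θ.toStage3Params.𝔸))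
        (H' : XSpace θ.toStage3Params.D i.k θ.toStage3Params.𝔸 →ₗ[ℂ] (Site θ.toStage3Params.D → θ.toStage3Params.𝔸)),
        (∀ x : Site θ.toStage3Params.D → θ.toStage3Params.𝔸, (∃ C : ℝ, ∀ y, ‖x y‖ ≤ C) → g (Δ x + qs (Aw (q x))) = x) ∧ (∀ φ, qs (c (q (g (g (qs φ))))) = qs φ) ∧
        (∀ (f : Site θ.toStage3Params.D → θ.toStage3Params.𝔸), ∀ x ∈ i.Ω 0, Δ f x = covLap i.η U₀ ((i.Ω 0).indicator f) x) ∧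
        (∀ (μ : ℕ → Site θ.toStage3Params.D → θ.toStage3Params.𝔸), ∀ x ∈ i.Ω 0, qs μ x = QT θ.toStage3Params.L i.k (i.Λs i.k) U₀ μ x) ∧
        (∀ (f : Site θ.toStage3Params.D → θ.toStage3Params.𝔸) (n : ℕ), n ≤ i.k → ∀ y ∈ i.Λs i.k n, q f n y = QprimeIter (zdBlocking θ.toStage3Params.D θ.toStage3Params.L) (bgT θ.toStage3Params.L U₀) n f y) ∧
        (∀ (f : Site θ.toStage3Params.D → θ.toStage3Params.𝔸) (n : ℕ) (y : Site θ.toStage3Params.D), ¬ (n ≤ i.k ∧ y ∈ i.Λs i.k n) → q f n y = 0) ∧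
        (∀ (X : XSpace θ.toStage3Params.D i.k θ.toStage3Params.𝔸) (x : Site θ.toStage3Params.D), ‖H' X x‖ ≤ B₀'H * ‖X‖) ∧
        (∀ n, n ≤ i.k → ∀ (X : XSpace θ.toStage3Params.D i.k θ.toStage3Params.𝔸), ∀ p ∈ {b : Site θ.toStage3Params.D × Fin θ.toStage3Params.D | SideTouches (i.Ω n) b.1 b.2},
          wt θ.toStage3Params.L i.η n * ‖covDerivFwd i.η U₀ p.2 (H' X) p.1‖ ≤ B₀'H * ‖X‖) ∧
        (∀ X : XSpace θ.toStage3Params.D i.k θ.toStage3Params.𝔸, Bd2 θ.toStage3Params.L i.η i.k i.Ω (covLap i.η U₀ (H' X)) (B₂' * ‖X‖)) ∧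
        (∀ (Y : XSpace θ.toStage3Params.D i.k θ.toStage3Params.𝔸) (n : ℕ) (hn : n ≤ i.k) (y : Site θ.toStage3Params.D), y ∈ i.Λs i.k n →
          QprimeIter (zdBlocking θ.toStage3Params.D θ.toStage3Params.L) (bgT θ.toStage3Params.L U₀) n (H' Y) y = Y (⟨n, Nat.lt_succ_of_le hn⟩, y)) ∧
        (∀ (f : Site θ.toStage3Params.D → θ.toStage3Params.𝔸) (r : ℝ), 0 ≤ r → Bd2 θ.toStage3Params.L i.η i.k i.Ω f r →
          (∀ x, ‖g f x‖ ≤ BG * r) ∧ ∀ n, n ≤ i.k → ∀ p ∈ {b : Site θ.toStage3Params.D × Fin θ.toStage3Params.D | SideTouches (i.Ω n) b.1 b.2},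
            wt θ.toStage3Params.L i.η n * ‖covDerivFwd i.η U₀ p.2 (g f) p.1‖ ≤ BG * r) ∧
        (∀ (f : Site θ.toStage3Params.D → θ.toStage3Params.𝔸) (r : ℝ), 0 ≤ r → Bd2 θ.toStage3Params.L i.η i.k i.Ω f r → Bd2 θ.toStage3Params.L i.η i.k i.Ω (f - g (qs (c (q (g f))))) (BR * r)))
    -- the SOURCELESS b9 socket of Proposition 3's frame over PRINT's class, at the law members only ([4] Thm 3.3; threshold `cB9`) — for Prop. 3 AS PRINTED
    (SB9P : ∀ i : ZdIdx θ.toStage3Params.D θ.toStage3Params.L, i.Ω 0 = Set.univ → IdxB8LawsB θ.toStage3Params.L i → B8ConstraintBonds.DomainSeq θ.toStage3Params.L i.Ω → (∀ l, l < i.k → ∀ z ∈ i.Λs i.k l, ((θ.toStage3Params.L : ℤ) ^ l) • z ∈ B8ConstraintBonds.Lam θ.toStage3Params.L i.Ω l) →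
      SockB9P3H2 (𝔸 := θ.toStage3Params.𝔸) θ.toStage3Params.L B₀ B₀β cB9 β len i.η i.k i.Ω i.Λs (fun m j => towerBondsP θ.toStage3Params.L i.Ω (i.Λs m) j))
    -- THEOREM 8's SOCKET-SIDE constants (source threshold `cP3`, source size factor `γ₈`, remainder slacks `γ′ γ″ γβ`) and the guard `2 ≤ 5dLB₀` on [4]'s `B₀` —
    -- NO layer equation, NO auxiliary `B₈ ∕ B₈β`, NO free-constant guard: those are CHOSEN ∕ DERIVED in the proof
    {cP3 γ₈ γ' γ'' γβ : ℝ} (hcP3 : 0 < cP3) (hγ₈ : 1 ≤ γ₈) (hγ' : 0 ≤ γ') (hγ'' : 0 ≤ γ'')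
    (hB : 2 ≤ 5 * (θ.toStage3Params.D : ℝ) * θ.toStage3Params.L * B₀) (hB₀β : 0 < B₀β)
    -- [Balaban1985BackgroundPropagators] Thm 3.3 WITH SOURCE in Theorem 4's frame at (1.146), γ′ letter, at the law members ONLY, asked RADIUS-UNIFORMLY: for every
    -- gauge-field radius scale `r ≥ 0` SOME threshold `c59 > 0` (print needs the one radius `r = O(B₁)`; [4] Thm 3.3 gives every `r` by shrinking its threshold) — HYPOTHESIS
    (SH59src : ∀ r : ℝ, 0 ≤ r → ∃ c59 : ℝ, 0 < c59 ∧ ∀ i : ZdIdx θ.toStage3Params.D θ.toStage3Params.L, i.Ω 0 = Set.univ → IdxB8LawsB θ.toStage3Params.L i → B8ConstraintBonds.DomainSeq θ.toStage3Params.L i.Ω → (∀ l, l < i.k → ∀ z ∈ i.Λs i.k l, ((θ.toStage3Params.L : ℤ) ^ l) • z ∈ B8ConstraintBonds.Lam θ.toStage3Params.L i.Ω l) → ∀ α₀ α₁ : ℝ, 0 < α₀ → 0 < α₁ → α₀ + α₁ ≤ c59 →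
      ∀ U₀ U' : Site θ.toStage3Params.D → Fin θ.toStage3Params.D → θ.toStage3Params.𝔸ˣ, (∀ x κ, U₀ x κ ∈ unitaryUnits θ.toStage3Params.𝔸) → (∀ x κ, U' x κ ∈ unitaryUnits θ.toStage3Params.𝔸) →
      ∀ φ : Site θ.toStage3Params.D → θ.toStage3Params.𝔸, ((InR138 θ.toStage3Params.L i.k i.η (i.Ω 0) (i.Λs i.k) U₀ φ ∧ (∀ x, IsSelfAdjoint (φ x)) ∧ (∀ x, x ∉ i.Ω 0 → φ x = 0) ∧
          Bdd θ.toStage3Params.L i.k i.η (-(2 : ℝ)) (fun j (x : Site θ.toStage3Params.D) => x ∈ i.Ω j) φ) ∧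
        msup θ.toStage3Params.L i.k i.η (-(2 : ℝ)) (fun j (x : Site θ.toStage3Params.D) => x ∈ i.Ω j) φ < γ₈ * (α₀ + α₁)) →
      InAk θ.toStage3Params.L i.k i.η α₀ i.Ω U₀ → InAk θ.toStage3Params.L i.k i.η α₀ i.Ω (mulCfg U' U₀) → (∀ m, m ≤ i.k → InAx θ.toStage3Params.L m (i.Λs m) U₀ (mulCfg U' U₀)) →
      (∀ j, j ≤ i.k → ∀ (z : Site θ.toStage3Params.D) (μ : Fin θ.toStage3Params.D),
        ((∀ x, InBox (tlo θ.toStage3Params.L z j) (thi θ.toStage3Params.L z j) x → x ∈ i.Ω j) ∨ (∀ x, InBox (tlo θ.toStage3Params.L (z + e μ) j) (thi θ.toStage3Params.L (z + e μ) j) x → x ∈ i.Ω j)) →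
        ‖(avgIter θ.toStage3Params.L (mulCfg U' U₀) j z μ : θ.toStage3Params.𝔸) - (avgIter θ.toStage3Params.L U₀ j z μ : θ.toStage3Params.𝔸)‖ ≤ α₁) →
      (∀ b ∈ {b : Site θ.toStage3Params.D × Fin θ.toStage3Params.D | SideTouches (i.Ω 0) b.1 b.2}, ‖((U' b.1 b.2 : θ.toStage3Params.𝔸ˣ) : θ.toStage3Params.𝔸) - 1‖ ≤ α₁) →
      (∀ m, 1 ≤ m → m ≤ i.k → ∀ (u : Site θ.toStage3Params.D → θ.toStage3Params.𝔸ˣ) (W : Site θ.toStage3Params.D → Fin θ.toStage3Params.D → θ.toStage3Params.𝔸ˣ) (A' : Site θ.toStage3Params.D → Fin θ.toStage3Params.D → θ.toStage3Params.𝔸),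
        (∀ x, u x ∈ unitaryUnits θ.toStage3Params.𝔸) → mgauge U₀ u W = U' → Restr129 θ.toStage3Params.L m (i.Λs m) U₀ u → LanF146 θ.toStage3Params.L i.k i.η (i.Ω 0) i.Λs U₀ φ m W →
        (∀ y τ, IsSelfAdjoint (A' y τ)) →
        (∀ j, j ≤ m → ∀ y τ, SideTouches (i.Ω j) y τ →
        W y τ = cfgExp i.η A' y τ ∧ ‖A' y τ‖ ≤ r * (α₀ + α₁) * ((θ.toStage3Params.L : ℝ) ^ j * i.η)⁻¹) →
        (∀ y τ, (∀ j, j ≤ m → ¬ SideTouches (i.Ω j) y τ) → A' y τ = 0) →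
        msup θ.toStage3Params.L m i.η (-(1 : ℝ)) (fun j (b : Site θ.toStage3Params.D × Fin θ.toStage3Params.D) => SideTouches (i.Ω j) b.1 b.2) (fun b => A' b.1 b.2)
        ≤ B₀ * (bondNorm θ.toStage3Params.L m i.η (-(3 : ℝ)) i.Ω (fun x μ => Jcur i.η U₀ A' μ x)
        + wsup 1 (fun p : {p : ℕ × (Site θ.toStage3Params.D × Fin θ.toStage3Params.D) // p.1 ≤ m ∧ p.2 ∈ towerBondsP θ.toStage3Params.L i.Ω (i.Λs m) p.1} =>
        linCovIter θ.toStage3Params.L U₀ (iEta i.η A') p.1.1 p.1.2.1 p.1.2.2)) + γ' * B₀ * (α₀ + α₁) ∧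
        msup θ.toStage3Params.L m i.η (-(2 : ℝ)) (fun j (t : Fin θ.toStage3Params.D × Fin θ.toStage3Params.D × Site θ.toStage3Params.D) => SideTouches (i.Ω j) t.2.2 t.2.1)
        (fun t => covDerivFwd i.η U₀ t.1 (fun z => A' z t.2.1) t.2.2)
        ≤ B₀ * (bondNorm θ.toStage3Params.L m i.η (-(3 : ℝ)) i.Ω (fun x μ => Jcur i.η U₀ A' μ x)
        + wsup 1 (fun p : {p : ℕ × (Site θ.toStage3Params.D × Fin θ.toStage3Params.D) // p.1 ≤ m ∧ p.2 ∈ towerBondsP θ.toStage3Params.L i.Ω (i.Λs m) p.1} =>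
        linCovIter θ.toStage3Params.L U₀ (iEta i.η A') p.1.1 p.1.2.1 p.1.2.2)) + γ' * B₀ * (α₀ + α₁)))
    -- THE SOURCED b9 SOCKET OF PROPOSITION 3's FRAME at the `Ω₀ = ℤᵈ` law members, threshold `cP3`, `|B₁|` over print's class at the top truncation — HYPOTHESIS
    -- ([Balaban1985BackgroundPropagators] Thm 3.3 with source; = `B8Prop3SrcZd3HPGamma`'s input letter for letter)
    (SB9srcHP : ∀ i : ZdIdx θ.toStage3Params.D θ.toStage3Params.L, i.Ω 0 = Set.univ → IdxB8LawsB θ.toStage3Params.L i → B8ConstraintBonds.DomainSeq θ.toStage3Params.L i.Ω → (∀ l, l < i.k → ∀ z ∈ i.Λs i.k l, ((θ.toStage3Params.L : ℤ) ^ l) • z ∈ B8ConstraintBonds.Lam θ.toStage3Params.L i.Ω l) → ∀ α₀ α₁ α₂ : ℝ, 0 < α₀ → α₀ ≤ cP3 → 0 < α₁ → 0 < α₂ → α₂ ≤ cP3 →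
      ∀ (U₀ W : Site θ.toStage3Params.D → Fin θ.toStage3Params.D → θ.toStage3Params.𝔸ˣ), (∀ x κ, U₀ x κ ∈ unitaryUnits θ.toStage3Params.𝔸) → (∀ x κ, W x κ ∈ unitaryUnits θ.toStage3Params.𝔸) →
      ∀ f : Site θ.toStage3Params.D → θ.toStage3Params.𝔸, InR138 θ.toStage3Params.L i.k i.η (i.Ω 0) (i.Λs i.k) U₀ f →
      (∀ x, IsSelfAdjoint (f x)) → (∀ x, x ∉ i.Ω 0 → f x = 0) →
      Bdd θ.toStage3Params.L i.k i.η (-(2 : ℝ)) (fun j (x : Site θ.toStage3Params.D) => x ∈ i.Ω j) f →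
      msup θ.toStage3Params.L i.k i.η (-(2 : ℝ)) (fun j (x : Site θ.toStage3Params.D) => x ∈ i.Ω j) f < γ₈ * (α₀ + α₁) →
      msup θ.toStage3Params.L i.k i.η (-(3 : ℝ)) (fun j (p : Fin θ.toStage3Params.D × Site θ.toStage3Params.D) => p.2 ∈ i.Ω j) (fun p => covDerivFwd i.η U₀ p.1 f p.2) < γ₈ * (α₀ + α₁) →
      InAk θ.toStage3Params.L i.k i.η α₀ i.Ω U₀ → InAk θ.toStage3Params.L i.k i.η α₀ i.Ω (mulCfg W U₀) → IsLandau146W θ.toStage3Params.L i.k i.η (i.Ω 0) (i.Λs i.k) U₀ f W →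
      ∀ A' : Site θ.toStage3Params.D → Fin θ.toStage3Params.D → θ.toStage3Params.𝔸, (∀ y τ, IsSelfAdjoint (A' y τ)) →
      (∀ j, j ≤ i.k → ∀ (y : Site θ.toStage3Params.D) (τ : Fin θ.toStage3Params.D), SideTouches (i.Ω j) y τ →
        W y τ = cfgExp i.η A' y τ ∧ ‖A' y τ‖ ≤ α₂ * ((θ.toStage3Params.L : ℝ) ^ j * i.η)⁻¹) →
      (∀ (y : Site θ.toStage3Params.D) (τ : Fin θ.toStage3Params.D), (∀ j, j ≤ i.k → ¬ SideTouches (i.Ω j) y τ) → A' y τ = 0) →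
      msup θ.toStage3Params.L i.k i.η (-(1 : ℝ)) (fun j (b : Site θ.toStage3Params.D × Fin θ.toStage3Params.D) => SideTouches (i.Ω j) b.1 b.2) (fun b => A' b.1 b.2)
          ≤ B₀ * (bondNorm θ.toStage3Params.L i.k i.η (-(3 : ℝ)) i.Ω (fun x μ => Jcur i.η U₀ A' μ x)
            + wsup 1 (fun p : {p : ℕ × (Site θ.toStage3Params.D × Fin θ.toStage3Params.D) // p.1 ≤ i.k ∧ p.2 ∈ towerBondsP θ.toStage3Params.L i.Ω (i.Λs i.k) p.1} =>
                linCovIter θ.toStage3Params.L U₀ (iEta i.η A') p.1.1 p.1.2.1 p.1.2.2)) + γ'' * B₀ * (α₀ + α₁) ∧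
        msup θ.toStage3Params.L i.k i.η (-(2 : ℝ)) (fun j (t : Fin θ.toStage3Params.D × Fin θ.toStage3Params.D × Site θ.toStage3Params.D) => SideTouches (i.Ω j) t.2.2 t.2.1)
            (fun t => covDerivFwd i.η U₀ t.1 (fun z => A' z t.2.1) t.2.2)
          ≤ B₀ * (bondNorm θ.toStage3Params.L i.k i.η (-(3 : ℝ)) i.Ω (fun x μ => Jcur i.η U₀ A' μ x)
            + wsup 1 (fun p : {p : ℕ × (Site θ.toStage3Params.D × Fin θ.toStage3Params.D) // p.1 ≤ i.k ∧ p.2 ∈ towerBondsP θ.toStage3Params.L i.Ω (i.Λs i.k) p.1} =>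
                linCovIter θ.toStage3Params.L U₀ (iEta i.η A') p.1.1 p.1.2.1 p.1.2.2)) + γ'' * B₀ * (α₀ + α₁) ∧
        bondNorm θ.toStage3Params.L i.k i.η (-(3 : ℝ)) i.Ω (fun x μ => pdiv i.η U₀ (plaqCovDeriv i.η U₀ A') μ x)
          ≤ B₀ * (bondNorm θ.toStage3Params.L i.k i.η (-(3 : ℝ)) i.Ω (fun x μ => Jcur i.η U₀ A' μ x)
            + wsup 1 (fun p : {p : ℕ × (Site θ.toStage3Params.D × Fin θ.toStage3Params.D) // p.1 ≤ i.k ∧ p.2 ∈ towerBondsP θ.toStage3Params.L i.Ω (i.Λs i.k) p.1} =>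
                linCovIter θ.toStage3Params.L U₀ (iEta i.η A') p.1.1 p.1.2.1 p.1.2.2)) + γ'' * B₀ * (α₀ + α₁) ∧
        bondNorm θ.toStage3Params.L i.k i.η (-(3 : ℝ)) i.Ω (fun x μ => covLap i.η U₀ (fun z => A' z μ) x)
          ≤ B₀ * (bondNorm θ.toStage3Params.L i.k i.η (-(3 : ℝ)) i.Ω (fun x μ => Jcur i.η U₀ A' μ x)
            + wsup 1 (fun p : {p : ℕ × (Site θ.toStage3Params.D × Fin θ.toStage3Params.D) // p.1 ≤ i.k ∧ p.2 ∈ towerBondsP θ.toStage3Params.L i.Ω (i.Λs i.k) p.1} =>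
                linCovIter θ.toStage3Params.L U₀ (iEta i.η A') p.1.1 p.1.2.1 p.1.2.2)) + γ'' * B₀ * (α₀ + α₁) ∧
        msup θ.toStage3Params.L i.k i.η (-(2 + β)) (fun j (q : Fin θ.toStage3Params.D × Fin θ.toStage3Params.D × (Site θ.toStage3Params.D × Site θ.toStage3Params.D)) => q.2.2 ∈ AdmPair i.η len ∧ q.2.2.1 ∈ i.Ω j ∧ q.2.2.2 ∈ i.Ω j)
            (fun q => hquot i.η β len U₀ (covDerivFwd i.η U₀ q.1 (fun z => A' z q.2.1)) q.2.2)
          ≤ B₀β * (bondNorm θ.toStage3Params.L i.k i.η (-(3 : ℝ)) i.Ω (fun x μ => Jcur i.η U₀ A' μ x)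
            + wsup 1 (fun p : {p : ℕ × (Site θ.toStage3Params.D × Fin θ.toStage3Params.D) // p.1 ≤ i.k ∧ p.2 ∈ towerBondsP θ.toStage3Params.L i.Ω (i.Λs i.k) p.1} =>
                linCovIter θ.toStage3Params.L U₀ (iEta i.η A') p.1.1 p.1.2.1 p.1.2.2)) + γβ * (α₀ + α₁)) :
    ∃ (lam : ResidB8 θ.toStage3Params) (c₁ : ℝ) (ρ₀ : ℕ) (w w' : WorldP), IsRecordOfRecord₁₃CSepCoPHSB8subBP₂D F N (datumOfRecord₁₃SepCoPH F N θ h) w ∧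
      w.C = (datumOfRecord₁₃SepCoPH F N θ h).C ∧ w.γ = γw ∧ w.L = (θ.L : ℝ) ∧
      (∀ P : B12.RunParams, w.up P = upOfRecord₅CSC F N ((θ.pinB8SubBP₂D F N (lam.cutSubBP₅ c₁ ρ₀)).toStage5₁₃CoPH F N) (c₇OfRecord θ.toStage3Params) P) ∧
      (∀ P : B12.RunParams, (leavesP w P).b8 ∧ Dag.B8_main (leavesP w P)) ∧
      IsRecordOfRecord₁₃CSepCoPH F N (datumOfRecord₁₃SepCoPH F N θ h) w' ∧ w'.C = w.C ∧ w'.γ = w.γ ∧ w'.L = w.L ∧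
      ∀ P : B12.RunParams, leavesP w P = { leavesP w' P with b8 := (leavesP w P).b8 } := by
  -- SOME residual layer, cut at dag-n05-w1's P₅-pin, inhabits the «P₂D» slot (dag-n05-d's ∃λ theorem (11); `2 ≤ D` from admissibility)
  obtain ⟨lam, c₁, ρ₀, hslot⟩ := exists_residB8_b8LeafOfRecordSubBP₂D_cutSubBP₅_of_lettersSrc_γ' θ.toStage3Params (hθ.toStage9.toStage8).1.1.1.1 hL5
    hcB9 hB₀'H hB₂' hBG hBR hcL SLet SLetUB SB9P hcP3 hγ₈ hγ' hγ'' hB hB₀β SH59src SB9srcHP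
  -- the CoPH record presented by `θ` at that layer, window `γw`, with companion (this seat's slot closer over dag-n05-w1's record module)
  exact ⟨lam, c₁, ρ₀, exists_isRecordOfRecord₁₃CSepCoPHSB8subBP₂D_b8_of_leaf θ h hθ (lam.cutSubBP₅ c₁ ρ₀) hslot hγ0 hγ1⟩

end AtRecordCoPH

/-! ## §2. … and in the `b8`-GENERIC S-class `IsRecordOfRecord₁₃CSepCoPHG` (the row a G-class-keyed K1 edition would read for N05; dag-n05-w1 g2's OFFER (a), cell bus 09:37Z) -/

section AtRecordG

variable {F : T4Family} {N : ℕ} [NeZero N]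

/-- ★ **… AND IN THE `b8`-GENERIC S-CLASS** (this seat's `IsRecordOfRecord₁₃CSepCoPHG`, p607735, through dag-n05-w1 g2's G-slice
`Record13CarriersB8SubBP2DCoPHG.isRecordOfRecord₁₃CSepCoPHG_of_isRecordOfRecord₁₃CSepCoPHSB8subBP₂D`, p621632; text = dag-n05-w1's OFFER (a) on the cell bus, 09:37Z): the
hypotheses of §1 ⊢ a G-CLASS world at `datumOfRecord₁₃SepCoPH F N θ h` bound to the SC-binding over the [B8″P₂D]-pinned v1.7 view at the P₅-pinned cut, `γ = γw`, every run's
`b8` leaf and `Dag.B8_main` — END from nodes there is `endStatementBPrinted_of_isRecordOfRecord₁₃CSepCoPHG_of_nodes` (displayed hypotheses: the other nodes, the β bounds).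
Sockets ∕ letters are HYPOTHESES (N06); N05 NOT discharged.
[cite: Balaban1985RegularSpaces, Lemma 1 – Thm 8 pp.79–101, Thm 8 (1.146) p.101; Balaban1985BackgroundPropagators, Thm 3.1 p.397, Thm 3.3 p.398; Balaban1989LargeFieldII, Thm 1 + (0.1) pp.355–356 (bookkeeping)] -/
theorem exists_isRecordOfRecord₁₃CSepCoPHG_b8_of_lettersSrc_γ' (θ : Stage13HParams F N) (h : θ.Provisos₁₃SepCoPH F N) (hθ : θ.Admissible F N)
    (hL5 : 5 ≤ θ.toStage3Params.L) {γw : ℝ} (hγ0 : 0 < γw) (hγ1 : γw ≤ θ.γ)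
    -- [Balaban1985BackgroundPropagators]'s PRIMITIVE constants read by the sockets: `B₀` (3.40), the Hölder pair `(β, B₀(β₀))` and length function, [4]'s letter bounds
    {B₀ B₀β β : ℝ} {len : Site θ.toStage3Params.D → ℝ}
    {cB9 B₀'H B₂' BG BR cL : ℝ}
    (hcB9 : 0 < cB9) (hB₀'H : 0 < B₀'H) (hB₂' : 0 ≤ B₂') (hBG : 0 ≤ BG) (hBR : 0 ≤ BR) (hcL : 0 < cL)
    -- [4]'s letters AT THE `Ω₀ = ℤᵈ` LAW MEMBERS ONLY: existence side (laws on print's domains) and uniqueness side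
    (SLet : ∀ i : ZdIdx θ.toStage3Params.D θ.toStage3Params.L, i.Ω 0 = Set.univ → IdxB8LawsB θ.toStage3Params.L i → B8ConstraintBonds.DomainSeq θ.toStage3Params.L i.Ω → (∀ l, l < i.k → ∀ z ∈ i.Λs i.k l, ((θ.toStage3Params.L : ℤ) ^ l) • z ∈ B8ConstraintBonds.Lam θ.toStage3Params.L i.Ω l) → SockLettersRD (𝔸 := θ.toStage3Params.𝔸) θ.toStage3Params.L BG BR B₀'H B₂' cL i.η i.k i.Ω i.Λs)
    (SLetUB : ∀ i : ZdIdx θ.toStage3Params.D θ.toStage3Params.L, i.Ω 0 = Set.univ → IdxB8LawsB θ.toStage3Params.L i → B8ConstraintBonds.DomainSeq θ.toStage3Params.L i.Ω → (∀ l, l < i.k → ∀ z ∈ i.Λs i.k l, ((θ.toStage3Params.L : ℤ) ^ l) • z ∈ B8ConstraintBonds.Lam θ.toStage3Params.L i.Ω l) → ∀ α₀ : ℝ, 0 < α₀ → α₀ ≤ cL → ∀ U₀ : Site θ.toStage3Params.D → Fin θ.toStage3Params.D → θ.toStage3Params.𝔸ˣ, (∀ x κ, U₀ x κ ∈ unitaryUnits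 θ.toStage3Params.𝔸) →
      InAk θ.toStage3Params.L i.k i.η α₀ i.Ω U₀ →
      ∃ (g Δ : (Site θ.toStage3Params.D → θ.toStage3Params.𝔸) →ₗ[ℂ] (Site θ.toStage3Params.D → θ.toStage3Params.𝔸)) (q : (Site θ.toStage3Params.D → θ.toStage3Params.𝔸) →ₗ[ℂ] (ℕ → Site θ.toStage3Params.D → θ.toStage3Params.𝔸))
        (qs : (ℕ → Site θ.toStage3Params.D → θ.toStage3Params.𝔸) →ₗ[ℂ] (Site θ.toStage3Params.D → θ.toStage3Params.𝔸)) (Aw c : (ℕ → Site θ.toStage3Params.D → θ.toStage3Params.𝔸) →ₗ[ℂ] (ℕ → Site θ.toStage3Params.D → θ.toStage3Params.𝔸))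
        (H' : XSpace θ.toStage3Params.D i.k θ.toStage3Params.𝔸 →ₗ[ℂ] (Site θ.toStage3Params.D → θ.toStage3Params.𝔸)),
        (∀ x : Site θ.toStage3Params.D → θ.toStage3Params.𝔸, (∃ C : ℝ, ∀ y, ‖x y‖ ≤ C) → g (Δ x + qs (Aw (q x))) = x) ∧ (∀ φ, qs (c (q (g (g (qs φ))))) = qs φ) ∧
        (∀ (f : Site θ.toStage3Params.D → θ.toStage3Params.𝔸), ∀ x ∈ i.Ω 0, Δ f x = covLap i.η U₀ ((i.Ω 0).indicator f) x) ∧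
        (∀ (μ : ℕ → Site θ.toStage3Params.D → θ.toStage3Params.𝔸), ∀ x ∈ i.Ω 0, qs μ x = QT θ.toStage3Params.L i.k (i.Λs i.k) U₀ μ x) ∧
        (∀ (f : Site θ.toStage3Params.D → θ.toStage3Params.𝔸) (n : ℕ), n ≤ i.k → ∀ y ∈ i.Λs i.k n, q f n y = QprimeIter (zdBlocking θ.toStage3Params.D θ.toStage3Params.L) (bgT θ.toStage3Params.L U₀) n f y) ∧
        (∀ (f : Site θ.toStage3Params.D → θ.toStage3Params.𝔸) (n : ℕ) (y : Site θ.toStage3Params.D), ¬ (n ≤ i.k ∧ y ∈ i.Λs i.k n) → q f n y = 0) ∧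
        (∀ (X : XSpace θ.toStage3Params.D i.k θ.toStage3Params.𝔸) (x : Site θ.toStage3Params.D), ‖H' X x‖ ≤ B₀'H * ‖X‖) ∧
        (∀ n, n ≤ i.k → ∀ (X : XSpace θ.toStage3Params.D i.k θ.toStage3Params.𝔸), ∀ p ∈ {b : Site θ.toStage3Params.D × Fin θ.toStage3Params.D | SideTouches (i.Ω n) b.1 b.2},
          wt θ.toStage3Params.L i.η n * ‖covDerivFwd i.η U₀ p.2 (H' X) p.1‖ ≤ B₀'H * ‖X‖) ∧
        (∀ X : XSpace θ.toStage3Params.D i.k θ.toStage3Params.𝔸, Bd2 θ.toStage3Params.L i.η i.k i.Ω (covLap i.η U₀ (H' X)) (B₂' * ‖X‖)) ∧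
        (∀ (Y : XSpace θ.toStage3Params.D i.k θ.toStage3Params.𝔸) (n : ℕ) (hn : n ≤ i.k) (y : Site θ.toStage3Params.D), y ∈ i.Λs i.k n →
          QprimeIter (zdBlocking θ.toStage3Params.D θ.toStage3Params.L) (bgT θ.toStage3Params.L U₀) n (H' Y) y = Y (⟨n, Nat.lt_succ_of_le hn⟩, y)) ∧
        (∀ (f : Site θ.toStage3Params.D → θ.toStage3Params.𝔸) (r : ℝ), 0 ≤ r → Bd2 θ.toStage3Params.L i.η i.k i.Ω f r →
          (∀ x, ‖g f x‖ ≤ BG * r) ∧ ∀ n, n ≤ i.k → ∀ p ∈ {b : Site θ.toStage3Params.D × Fin θ.toStage3Params.D | SideTouches (i.Ω n) b.1 b.2},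
            wt θ.toStage3Params.L i.η n * ‖covDerivFwd i.η U₀ p.2 (g f) p.1‖ ≤ BG * r) ∧
        (∀ (f : Site θ.toStage3Params.D → θ.toStage3Params.𝔸) (r : ℝ), 0 ≤ r → Bd2 θ.toStage3Params.L i.η i.k i.Ω f r → Bd2 θ.toStage3Params.L i.η i.k i.Ω (f - g (qs (c (q (g f))))) (BR * r)))
    -- the SOURCELESS b9 socket of Proposition 3's frame over PRINT's class, at the law members only ([4] Thm 3.3; threshold `cB9`) — for Prop. 3 AS PRINTED
    (SB9P : ∀ i : ZdIdx θ.toStage3Params.D θ.toStage3Params.L, i.Ω 0 = Set.univ → IdxB8LawsB θ.toStage3Params.L i → B8ConstraintBonds.DomainSeq θ.toStage3Params.L i.Ω → (∀ l, l < i.k → ∀ z ∈ i.Λs i.k l, ((θ.toStage3Params.L : ℤ) ^ l) • z ∈ B8ConstraintBonds.Lam θ.toStage3Params.L i.Ω l) →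
      SockB9P3H2 (𝔸 := θ.toStage3Params.𝔸) θ.toStage3Params.L B₀ B₀β cB9 β len i.η i.k i.Ω i.Λs (fun m j => towerBondsP θ.toStage3Params.L i.Ω (i.Λs m) j))
    -- THEOREM 8's SOCKET-SIDE constants (source threshold `cP3`, source size factor `γ₈`, remainder slacks `γ′ γ″ γβ`) and the guard `2 ≤ 5dLB₀` on [4]'s `B₀` —
    -- NO layer equation, NO auxiliary `B₈ ∕ B₈β`, NO free-constant guard: those are CHOSEN ∕ DERIVED in the proof
    {cP3 γ₈ γ' γ'' γβ : ℝ} (hcP3 : 0 < cP3) (hγ₈ : 1 ≤ γ₈) (hγ' : 0 ≤ γ') (hγ'' : 0 ≤ γ'')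
    (hB : 2 ≤ 5 * (θ.toStage3Params.D : ℝ) * θ.toStage3Params.L * B₀) (hB₀β : 0 < B₀β)
    -- [Balaban1985BackgroundPropagators] Thm 3.3 WITH SOURCE in Theorem 4's frame at (1.146), γ′ letter, at the law members ONLY, asked RADIUS-UNIFORMLY: for every
    -- gauge-field radius scale `r ≥ 0` SOME threshold `c59 > 0` (print needs the one radius `r = O(B₁)`; [4] Thm 3.3 gives every `r` by shrinking its threshold) — HYPOTHESIS
    (SH59src : ∀ r : ℝ, 0 ≤ r → ∃ c59 : ℝ, 0 < c59 ∧ ∀ i : ZdIdx θ.toStage3Params.D θ.toStage3Params.L, i.Ω 0 = Set.univ → IdxB8LawsB θ.toStage3Params.L i → B8ConstraintBonds.DomainSeq θ.toStage3Params.L i.Ω → (∀ l, l < i.k → ∀ z ∈ i.Λs i.k l, ((θ.toStage3Params.L : ℤ) ^ l) • z ∈ B8ConstraintBonds.Lam θ.toStage3Params.L i.Ω l) → ∀ α₀ α₁ : ℝ, 0 < α₀ → 0 < α₁ → α₀ + α₁ ≤ c59 →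
      ∀ U₀ U' : Site θ.toStage3Params.D → Fin θ.toStage3Params.D → θ.toStage3Params.𝔸ˣ, (∀ x κ, U₀ x κ ∈ unitaryUnits θ.toStage3Params.𝔸) → (∀ x κ, U' x κ ∈ unitaryUnits θ.toStage3Params.𝔸) →
      ∀ φ : Site θ.toStage3Params.D → θ.toStage3Params.𝔸, ((InR138 θ.toStage3Params.L i.k i.η (i.Ω 0) (i.Λs i.k) U₀ φ ∧ (∀ x, IsSelfAdjoint (φ x)) ∧ (∀ x, x ∉ i.Ω 0 → φ x = 0) ∧
          Bdd θ.toStage3Params.L i.k i.η (-(2 : ℝ)) (fun j (x : Site θ.toStage3Params.D) => x ∈ i.Ω j) φ) ∧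
        msup θ.toStage3Params.L i.k i.η (-(2 : ℝ)) (fun j (x : Site θ.toStage3Params.D) => x ∈ i.Ω j) φ < γ₈ * (α₀ + α₁)) →
      InAk θ.toStage3Params.L i.k i.η α₀ i.Ω U₀ → InAk θ.toStage3Params.L i.k i.η α₀ i.Ω (mulCfg U' U₀) → (∀ m, m ≤ i.k → InAx θ.toStage3Params.L m (i.Λs m) U₀ (mulCfg U' U₀)) →
      (∀ j, j ≤ i.k → ∀ (z : Site θ.toStage3Params.D) (μ : Fin θ.toStage3Params.D),
        ((∀ x, InBox (tlo θ.toStage3Params.L z j) (thi θ.toStage3Params.L z j) x → x ∈ i.Ω j) ∨ (∀ x, InBox (tlo θ.toStage3Params.L (z + e μ) j) (thi θ.toStage3Params.L (z + e μ) j) x → x ∈ i.Ω j)) →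
        ‖(avgIter θ.toStage3Params.L (mulCfg U' U₀) j z μ : θ.toStage3Params.𝔸) - (avgIter θ.toStage3Params.L U₀ j z μ : θ.toStage3Params.𝔸)‖ ≤ α₁) →
      (∀ b ∈ {b : Site θ.toStage3Params.D × Fin θ.toStage3Params.D | SideTouches (i.Ω 0) b.1 b.2}, ‖((U' b.1 b.2 : θ.toStage3Params.𝔸ˣ) : θ.toStage3Params.𝔸) - 1‖ ≤ α₁) →
      (∀ m, 1 ≤ m → m ≤ i.k → ∀ (u : Site θ.toStage3Params.D → θ.toStage3Params.𝔸ˣ) (W : Site θ.toStage3Params.D → Fin θ.toStage3Params.D → θ.toStage3Params.𝔸ˣ) (A' : Site θ.toStage3Params.D → Fin θ.toStage3Params.D → θ.toStage3Params.𝔸),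
        (∀ x, u x ∈ unitaryUnits θ.toStage3Params.𝔸) → mgauge U₀ u W = U' → Restr129 θ.toStage3Params.L m (i.Λs m) U₀ u → LanF146 θ.toStage3Params.L i.k i.η (i.Ω 0) i.Λs U₀ φ m W →
        (∀ y τ, IsSelfAdjoint (A' y τ)) →
        (∀ j, j ≤ m → ∀ y τ, SideTouches (i.Ω j) y τ →
        W y τ = cfgExp i.η A' y τ ∧ ‖A' y τ‖ ≤ r * (α₀ + α₁) * ((θ.toStage3Params.L : ℝ) ^ j * i.η)⁻¹) →
        (∀ y τ, (∀ j, j ≤ m → ¬ SideTouches (i.Ω j) y τ) → A' y τ = 0) →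
        msup θ.toStage3Params.L m i.η (-(1 : ℝ)) (fun j (b : Site θ.toStage3Params.D × Fin θ.toStage3Params.D) => SideTouches (i.Ω j) b.1 b.2) (fun b => A' b.1 b.2)
        ≤ B₀ * (bondNorm θ.toStage3Params.L m i.η (-(3 : ℝ)) i.Ω (fun x μ => Jcur i.η U₀ A' μ x)
        + wsup 1 (fun p : {p : ℕ × (Site θ.toStage3Params.D × Fin θ.toStage3Params.D) // p.1 ≤ m ∧ p.2 ∈ towerBondsP θ.toStage3Params.L i.Ω (i.Λs m) p.1} =>
        linCovIter θ.toStage3Params.L U₀ (iEta i.η A') p.1.1 p.1.2.1 p.1.2.2)) + γ' * B₀ * (α₀ + α₁) ∧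
        msup θ.toStage3Params.L m i.η (-(2 : ℝ)) (fun j (t : Fin θ.toStage3Params.D × Fin θ.toStage3Params.D × Site θ.toStage3Params.D) => SideTouches (i.Ω j) t.2.2 t.2.1)
        (fun t => covDerivFwd i.η U₀ t.1 (fun z => A' z t.2.1) t.2.2)
        ≤ B₀ * (bondNorm θ.toStage3Params.L m i.η (-(3 : ℝ)) i.Ω (fun x μ => Jcur i.η U₀ A' μ x)
        + wsup 1 (fun p : {p : ℕ × (Site θ.toStage3Params.D × Fin θ.toStage3Params.D) // p.1 ≤ m ∧ p.2 ∈ towerBondsP θ.toStage3Params.L i.Ω (i.Λs m) p.1} =>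
        linCovIter θ.toStage3Params.L U₀ (iEta i.η A') p.1.1 p.1.2.1 p.1.2.2)) + γ' * B₀ * (α₀ + α₁)))
    -- THE SOURCED b9 SOCKET OF PROPOSITION 3's FRAME at the `Ω₀ = ℤᵈ` law members, threshold `cP3`, `|B₁|` over print's class at the top truncation — HYPOTHESIS
    -- ([Balaban1985BackgroundPropagators] Thm 3.3 with source; = `B8Prop3SrcZd3HPGamma`'s input letter for letter)
    (SB9srcHP : ∀ i : ZdIdx θ.toStage3Params.D θ.toStage3Params.L, i.Ω 0 = Set.univ → IdxB8LawsB θ.toStage3Params.L i → B8ConstraintBonds.DomainSeq θ.toStage3Params.L i.Ω → (∀ l, l < i.k → ∀ z ∈ i.Λs i.k l, ((θ.toStage3Params.L : ℤ) ^ l) • z ∈ B8ConstraintBonds.Lam θ.toStage3Params.L i.Ω l) → ∀ α₀ α₁ α₂ : ℝ, 0 < α₀ → α₀ ≤ cP3 → 0 < α₁ → 0 < α₂ → α₂ ≤ cP3 →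
      ∀ (U₀ W : Site θ.toStage3Params.D → Fin θ.toStage3Params.D → θ.toStage3Params.𝔸ˣ), (∀ x κ, U₀ x κ ∈ unitaryUnits θ.toStage3Params.𝔸) → (∀ x κ, W x κ ∈ unitaryUnits θ.toStage3Params.𝔸) →
      ∀ f : Site θ.toStage3Params.D → θ.toStage3Params.𝔸, InR138 θ.toStage3Params.L i.k i.η (i.Ω 0) (i.Λs i.k) U₀ f →
      (∀ x, IsSelfAdjoint (f x)) → (∀ x, x ∉ i.Ω 0 → f x = 0) →
      Bdd θ.toStage3Params.L i.k i.η (-(2 : ℝ)) (fun j (x : Site θ.toStage3Params.D) => x ∈ i.Ω j) f →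
      msup θ.toStage3Params.L i.k i.η (-(2 : ℝ)) (fun j (x : Site θ.toStage3Params.D) => x ∈ i.Ω j) f < γ₈ * (α₀ + α₁) →
      msup θ.toStage3Params.L i.k i.η (-(3 : ℝ)) (fun j (p : Fin θ.toStage3Params.D × Site θ.toStage3Params.D) => p.2 ∈ i.Ω j) (fun p => covDerivFwd i.η U₀ p.1 f p.2) < γ₈ * (α₀ + α₁) →
      InAk θ.toStage3Params.L i.k i.η α₀ i.Ω U₀ → InAk θ.toStage3Params.L i.k i.η α₀ i.Ω (mulCfg W U₀) → IsLandau146W θ.toStage3Params.L i.k i.η (i.Ω 0) (i.Λs i.k) U₀ f W →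
      ∀ A' : Site θ.toStage3Params.D → Fin θ.toStage3Params.D → θ.toStage3Params.𝔸, (∀ y τ, IsSelfAdjoint (A' y τ)) →
      (∀ j, j ≤ i.k → ∀ (y : Site θ.toStage3Params.D) (τ : Fin θ.toStage3Params.D), SideTouches (i.Ω j) y τ →
        W y τ = cfgExp i.η A' y τ ∧ ‖A' y τ‖ ≤ α₂ * ((θ.toStage3Params.L : ℝ) ^ j * i.η)⁻¹) →
      (∀ (y : Site θ.toStage3Params.D) (τ : Fin θ.toStage3Params.D), (∀ j, j ≤ i.k → ¬ SideTouches (i.Ω j) y τ) → A' y τ = 0) →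
      msup θ.toStage3Params.L i.k i.η (-(1 : ℝ)) (fun j (b : Site θ.toStage3Params.D × Fin θ.toStage3Params.D) => SideTouches (i.Ω j) b.1 b.2) (fun b => A' b.1 b.2)
          ≤ B₀ * (bondNorm θ.toStage3Params.L i.k i.η (-(3 : ℝ)) i.Ω (fun x μ => Jcur i.η U₀ A' μ x)
            + wsup 1 (fun p : {p : ℕ × (Site θ.toStage3Params.D × Fin θ.toStage3Params.D) // p.1 ≤ i.k ∧ p.2 ∈ towerBondsP θ.toStage3Params.L i.Ω (i.Λs i.k) p.1} =>
                linCovIter θ.toStage3Params.L U₀ (iEta i.η A') p.1.1 p.1.2.1 p.1.2.2)) + γ'' * B₀ * (α₀ + α₁) ∧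
        msup θ.toStage3Params.L i.k i.η (-(2 : ℝ)) (fun j (t : Fin θ.toStage3Params.D × Fin θ.toStage3Params.D × Site θ.toStage3Params.D) => SideTouches (i.Ω j) t.2.2 t.2.1)
            (fun t => covDerivFwd i.η U₀ t.1 (fun z => A' z t.2.1) t.2.2)
          ≤ B₀ * (bondNorm θ.toStage3Params.L i.k i.η (-(3 : ℝ)) i.Ω (fun x μ => Jcur i.η U₀ A' μ x)
            + wsup 1 (fun p : {p : ℕ × (Site θ.toStage3Params.D × Fin θ.toStage3Params.D) // p.1 ≤ i.k ∧ p.2 ∈ towerBondsP θ.toStage3Params.L i.Ω (i.Λs i.k) p.1} =>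
                linCovIter θ.toStage3Params.L U₀ (iEta i.η A') p.1.1 p.1.2.1 p.1.2.2)) + γ'' * B₀ * (α₀ + α₁) ∧
        bondNorm θ.toStage3Params.L i.k i.η (-(3 : ℝ)) i.Ω (fun x μ => pdiv i.η U₀ (plaqCovDeriv i.η U₀ A') μ x)
          ≤ B₀ * (bondNorm θ.toStage3Params.L i.k i.η (-(3 : ℝ)) i.Ω (fun x μ => Jcur i.η U₀ A' μ x)
            + wsup 1 (fun p : {p : ℕ × (Site θ.toStage3Params.D × Fin θ.toStage3Params.D) // p.1 ≤ i.k ∧ p.2 ∈ towerBondsP θ.toStage3Params.L i.Ω (i.Λs i.k) p.1} =>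
                linCovIter θ.toStage3Params.L U₀ (iEta i.η A') p.1.1 p.1.2.1 p.1.2.2)) + γ'' * B₀ * (α₀ + α₁) ∧
        bondNorm θ.toStage3Params.L i.k i.η (-(3 : ℝ)) i.Ω (fun x μ => covLap i.η U₀ (fun z => A' z μ) x)
          ≤ B₀ * (bondNorm θ.toStage3Params.L i.k i.η (-(3 : ℝ)) i.Ω (fun x μ => Jcur i.η U₀ A' μ x)
            + wsup 1 (fun p : {p : ℕ × (Site θ.toStage3Params.D × Fin θ.toStage3Params.D) // p.1 ≤ i.k ∧ p.2 ∈ towerBondsP θ.toStage3Params.L i.Ω (i.Λs i.k) p.1} =>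
                linCovIter θ.toStage3Params.L U₀ (iEta i.η A') p.1.1 p.1.2.1 p.1.2.2)) + γ'' * B₀ * (α₀ + α₁) ∧
        msup θ.toStage3Params.L i.k i.η (-(2 + β)) (fun j (q : Fin θ.toStage3Params.D × Fin θ.toStage3Params.D × (Site θ.toStage3Params.D × Site θ.toStage3Params.D)) => q.2.2 ∈ AdmPair i.η len ∧ q.2.2.1 ∈ i.Ω j ∧ q.2.2.2 ∈ i.Ω j)
            (fun q => hquot i.η β len U₀ (covDerivFwd i.η U₀ q.1 (fun z => A' z q.2.1)) q.2.2)
          ≤ B₀β * (bondNorm θ.toStage3Params.L i.k i.η (-(3 : ℝ)) i.Ω (fun x μ => Jcur i.η U₀ A' μ x)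
            + wsup 1 (fun p : {p : ℕ × (Site θ.toStage3Params.D × Fin θ.toStage3Params.D) // p.1 ≤ i.k ∧ p.2 ∈ towerBondsP θ.toStage3Params.L i.Ω (i.Λs i.k) p.1} =>
                linCovIter θ.toStage3Params.L U₀ (iEta i.η A') p.1.1 p.1.2.1 p.1.2.2)) + γβ * (α₀ + α₁)) :
    ∃ (lam : ResidB8 θ.toStage3Params) (c₁ : ℝ) (ρ₀ : ℕ) (w : WorldP), IsRecordOfRecord₁₃CSepCoPHG F N (datumOfRecord₁₃SepCoPH F N θ h) w ∧ w.γ = γw ∧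
      (∀ P : B12.RunParams, w.up P = upOfRecord₅CSC F N ((θ.pinB8SubBP₂D F N (lam.cutSubBP₅ c₁ ρ₀)).toStage5₁₃CoPH F N) (c₇OfRecord θ.toStage3Params) P) ∧
      ∀ P : B12.RunParams, (leavesP w P).b8 ∧ Dag.B8_main (leavesP w P) := by
  obtain ⟨lam, c₁, ρ₀, w, -, hw, -, hγ, -, hup, hmain, -⟩ := exists_isRecordOfRecord₁₃CSepCoPHSB8subBP₂D_b8_of_lettersSrc_γ' θ h hθ hL5 hγ0 hγ1
    hcB9 hB₀'H hB₂' hBG hBR hcL SLet SLetUB SB9P hcP3 hγ₈ hγ' hγ'' hB hB₀β SH59src SB9srcHP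
  exact ⟨lam, c₁, ρ₀, w, isRecordOfRecord₁₃CSepCoPHG_of_isRecordOfRecord₁₃CSepCoPHSB8subBP₂D hw, hγ, hup, hmain⟩

end AtRecordG

end Summit.QuantumFields.YangMills.BalabanUVNodes.N05AtRecord13SubBP2DSepCoPHOfSocketsGammaPrime

end
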